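import Mathlib
import Summits.QuantumFields.QCD.Theses.PauliWegnerSea
import Literature.MathematicalPhysics.QuantumFieldTheory.QCDHeavyQuarkPropagator
import Literature.MathematicalPhysics.QuantumFieldTheory.QCDWickMinorMeasurability
import Literature.MathematicalPhysics.QuantumFieldTheory.QCDPhaseQuenchedPositivity

/-!
# Minor moments core from its reg-free uniform form

Crux `stmt-QuantumFields-9151` (`PhaseQuenchedFlavourDecay`), line crossing-split-integrability.
Pure bookkeeping: the reg-free UNIFORM core — Fredenhagen–Marcu data `(s, C, μ)` at a lattice
parameter point `(β, mq)` control the `(1 + ε)`-moments of the Wick minors with constants depending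
on `(s, C)` only, once the rate `μ` is below `μ₀` and the volume satisfies `Λ₀ ≤ μ L` — implies the
registered core `stub_minorMomentsCore` along any `QCDRegularisation`, by specialising to the bare
trajectory `mq_k = m_crit(k) + a_k m / Z_m(k)`, rate `μ_k = δ a_k → 0` and `μ_k L_k = δ (a_k L_k) → ∞`.
-/

noncomputable section

namespace Summit.QuantumFields.QCD.Cruxes.PhaseQuenchedFlavourDecay.CrossingSplitIntegrability

open scoped BigOperators
open MeasureTheory Filter
open Literature.MathematicalPhysics.QuantumFieldTheory Literature.MathematicalPhysics.QuantumLattice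
  Literature.Probability.LatticeModels

/-- W2 (bookkeeping): the reg-free UNIFORM minor-moments core implies the registered core
`stub_minorMomentsCore`. Along a regularisation `reg` with decay rate `δ a_k` in lattice units,
eventually `δ a_k ≤ μ₀` (`a_k → 0`) and `Λ₀ ≤ δ a_k L_k` (`a_k L_k → ∞`), so the uniform bound
applies at every late step `k` with the `(s, C)`-dependent constant `Cr`. -/
theorem stub_minorMomentsCore_of_uniform :
    (∀ (Nf : ℕ) (s C : ℝ), 0 < s → s < 1 → ∃ ε : ℝ, 0 < ε ∧ ∀ r : ℕ, ∃ Cr μ₀ Λ₀ : ℝ, 0 < μ₀ ∧ ∀ (β : ℝ) (mq : Fin Nf → ℝ) (μ : ℝ) (L : ℕ), 0 < μ → μ ≤ μ₀ → Λ₀ ≤ μ * L → (∀ S : ℕ, L ≤ S → ∀ (f : Fin Nf) (v : Literature.Probability.LatticeModels.Site 4), v ∈ box 4 S → (∫ U : GaugeConfig 4 (2 * S + 1) (Matrix.specialUnitaryGroup (Fin 3) ℂ), ‖(diracMatrix U mq).det‖ * (∑ a : Fin 3, ∑ i : Fin 4, ∑ b : Fin 3, ∑ j : Fin 4, ‖(diracMatrix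 U mq)⁻¹ (quarkEquiv (f, (Torus.proj (2 * S + 1) 0, a, i))) (quarkEquiv (f, (Torus.proj (2 * S + 1) (v), b, j)))‖) ^ s ∂(wilsonMeasure (fundamentalRep (Fin 3)) β)) / (∫ U : GaugeConfig 4 (2 * S + 1) (Matrix.specialUnitaryGroup (Fin 3) ℂ), ‖(diracMatrix U mq).det‖ ∂(wilsonMeasure (fundamentalRep (Fin 3)) β)) ≤ C * Real.exp (-(μ * ‖v‖))) → ∀ S : ℕ, L ≤ S → ∀ I J : Fin r → QuarkVar Nf (2 * S + 1), Integrable (fun U : GaugeConfig 4 (2 * S + 1) SU3 => ‖(Matrix.of fun a b : Fin r => (diracMatrix U mq)⁻¹ (quarkEquiv (I a)) (quarkEquiv (J b))).det‖ ^ (1 + ε)) (qcdLatticeMeasure (2 * S + 1) β mq) ∧ qcdPhaseQuenchedExpect β (2 * S + 1) mq (fun U : GaugeConfig 4 (2 * S + 1) SU3 => ‖(Matrix.of fun a b : Fin r => (diracMatrix U mq)⁻¹ (quarkEquiv (I a)) (quarkEquiv (J b))).det‖ ^ (1 + ε)) ≤ Cr) →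
    ∀ (Nf : ℕ) (reg : QCDRegularisation Nf) (m : Fin Nf → ℝ), (∀ f, 0 < m f) → (∃ s δ C : ℝ, 0 < s ∧ s < 1 ∧ 0 < δ ∧ ∀ᶠ k in atTop, ∀ S : ℕ, reg.L k ≤ S → ∀ (f : Fin Nf) (v : Literature.Probability.LatticeModels.Site 4), v ∈ box 4 S → (∫ U : GaugeConfig 4 (2 * S + 1) (Matrix.specialUnitaryGroup (Fin 3) ℂ), ‖(diracMatrix U fun fl => reg.mcrit k + reg.a k * m fl / reg.Zm k).det‖ * (∑ a : Fin 3, ∑ i : Fin 4, ∑ b : Fin 3, ∑ j : Fin 4, ‖(diracMatrix U fun fl => reg.mcrit k + reg.a k * m fl / reg.Zm k)⁻¹ (quarkEquiv (f, (Torus.proj (2 * S + 1) 0, a, i))) (quarkEquiv (f, (Torus.proj (2 * S + 1) (v), b, j)))‖) ^ s ∂(wilsonMeasure (fundamentalRep (Fin 3)) (reg.β k))) / (∫ U : GaugeConfig 4 (2 * S + 1) (Matrix.specialUnitaryGroup (Fin 3) ℂ), ‖(diracMatrix U fun fl => reg.mcrit k + reg.a k * m fl / reg.Zm k).det‖ ∂(wilsonMeasure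 (fundamentalRep (Fin 3)) (reg.β k))) ≤ C * Real.exp (-(δ * (reg.a k * ‖v‖)))) → ∃ ε : ℝ, 0 < ε ∧ ∀ r : ℕ, ∃ C : ℝ, ∀ᶠ k in atTop, ∀ S : ℕ, reg.L k ≤ S → ∀ I J : Fin r → QuarkVar Nf (2 * S + 1), Integrable (fun U : GaugeConfig 4 (2 * S + 1) SU3 => ‖(Matrix.of fun a b : Fin r => (diracMatrix U fun fl => reg.mcrit k + reg.a k * m fl / reg.Zm k)⁻¹ (quarkEquiv (I a)) (quarkEquiv (J b))).det‖ ^ (1 + ε)) (qcdLatticeMeasure (2 * S + 1) (reg.β k) fun fl => reg.mcrit k + reg.a k * m fl / reg.Zm k) ∧ qcdPhaseQuenchedExpect (reg.β k) (2 * S + 1) (fun fl => reg.mcrit k + reg.a k * m fl / reg.Zm k) (fun U : GaugeConfig 4 (2 * S + 1) SU3 => ‖(Matrix.of fun a b : Fin r => (diracMatrix U fun fl => reg.mcrit k + reg.a k * m fl / reg.Zm k)⁻¹ (quarkEquiv (I a)) (quarkEquiv (J b))).det‖ ^ (1 + ε)) ≤ C := by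
  intro hU Nf reg m _hm hFM
  obtain ⟨s, δ, C, hs, hs1, hδ, hUp⟩ := hFM
  obtain ⟨ε, hε, hr⟩ := hU Nf s C hs hs1
  refine ⟨ε, hε, fun r => ?_⟩
  obtain ⟨Cr, μ₀, Λ₀, hμ₀, hmain⟩ := hr r
  refine ⟨Cr, ?_⟩
  -- (i) the rate `δ * a k` is eventually below `μ₀` since `a k → 0`
  have h1 : ∀ᶠ k in atTop, δ * reg.a k ≤ μ₀ := by
    have h : Tendsto (fun k => δ * reg.a k) atTop (nhds (δ * 0)) := reg.tendsto_a.const_mul δ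
    rw [mul_zero] at h
    exact h.eventually_le_const hμ₀
  -- (ii) `Λ₀ ≤ (δ * a k) * L k` eventually since `a k * L k → ∞`
  have h2 : ∀ᶠ k in atTop, Λ₀ ≤ δ * reg.a k * (reg.L k : ℝ) := by
    have h : Tendsto (fun k => δ * (reg.a k * reg.L k)) atTop atTop :=
      reg.tendsto_L.const_mul_atTop hδ
    filter_upwards [h.eventually_ge_atTop Λ₀] with k hk
    rw [mul_assoc]
    exact hk
  filter_upwards [h1, h2, hUp] with k hk1 hk2 hk3 S hS I J
  exact hmain (reg.β k) (fun fl => reg.mcrit k + reg.a k * m fl / reg.Zm k) (δ * reg.a k) (reg.L k)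
    (mul_pos hδ (reg.a_pos k)) hk1 hk2
    (fun S' hS' f v hv => by
      have e : δ * reg.a k * ‖v‖ = δ * (reg.a k * ‖v‖) := mul_assoc _ _ _
      rw [e]
      exact hk3 S' hS' f v hv)
    S hS I J


end Summit.QuantumFields.QCD.Cruxes.PhaseQuenchedFlavourDecay.CrossingSplitIntegrability
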